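import Summits.BirchSwinnertonDyer.Rank1Residual.ManinAdditive.BlindFamilyBSDTwo
import Summits.BirchSwinnertonDyer.Rank1Residual.ManinAdditive.OddDegreeTooth
import Summits.BirchSwinnertonDyer.Rank1Residual.Supersingular.RationalLadder
import Summits.BirchSwinnertonDyer.Rank1Residual.Supersingular.CountPointsFast
import Summits.BirchSwinnertonDyer.BirchSwinnertonDyer.Theorems.Rank1ResidualIntModelReduction
import Summits.BirchSwinnertonDyer.BirchSwinnertonDyer.Theorems.Rank1ResidualX11RankOneReduction
import Literature.NumberTheory.EllipticCurves.Rank1Residual.X11RankOneCertificates.Minimality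
import Literature.NumberTheory.EllipticCurves.AnomalousOfRationalTorsionProofs
import Summits.BirchSwinnertonDyer.Rank1Residual.X5.TwoAdicInstancesToolkitKraus3
import Mathlib.NumberTheory.Real.Irrational
import HarnessLib
import HarnessLib.Audit.Tags

/-!
# E-an-103♭ `BlindFamilyTorsionLaw`, PART A: the blind family `E′_m` is globally minimal; its reductions at `3` and `5`
# (cell `bsd-f2-manin`, crux C2 `ManinOddAtFour` stmt-BirchSwinnertonDyer-22967 — the blind TAME residual of line
# `kato_shift_two` IS this family; an's THEOREM TARGET of `BlindFamilyBSDTwo.lean`, MEMO-an §65; C2/C3 LEAD p1 gen 8)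

Summit `BirchSwinnertonDyer`, route `ManinLocalTwoThree`.  The typed row E-an-103♭
`Summit.BirchSwinnertonDyer.Rank1Residual.ManinAdditive.BlindFamilyTorsionLaw` («PAPER THEOREM — Lutz–Nagell; theorem target;
nothing asserted», refuter-1 §R68 SURVIVES) is discharged BY NAME in the sibling `…BlindFamilyTorsion.lean` (PART B); this PART A carries steps 1–2 for the blind family
`E′_m = ShimuraLedger.blindCurve m : y² = x³ − 2m x² + (m² + 4) x`:
for odd `m` with `3 ≤ |m|` and `p = m² + 4` prime, `#E′_m(ℚ)_tors = 2`.

## Proof (Knapp's route for `y² = x³ + Ax`, as the tree's `CongruentNumberCurveTorsionProofs`, with two fixed good primes)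

1. `E′_m` is its own global minimal model (`isGloballyMinimal_of_int_criterion`: `Δ = −2⁸p²`, `c₄ = 2⁴(m² − 12)`; `2¹² ∤ Δ`
   because `p` is odd, and an odd prime `q` with `q ∣ Δ`, `q ∣ c₄` would divide `(m² + 4) − (m² − 12) = 16`).
2. `3 ∤ Δ` and `5 ∤ Δ` (`p ≡ m² + 1 ≢ 0 (3)`; `5 ∣ m² + 4` forces `p = 5`, `|m| = 1`), and the reductions are read off
   `m mod 3`, `m mod 5`: `#Ẽ′_m(𝔽₃) ∈ {4, 6, 2}`, `#Ẽ′_m(𝔽₅) ∈ {8, 4}` (kernel point counts of the six residue curves,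
   `Supersingular.natCard_point_eq_of_countPoints`).  Hence every rational torsion point has order dividing `4`
   (`addOrderOf_dvd_reductionPointCount` at `3` and `5`, Silverman VII.3.1(b)).
3. No rational point of order `4` (duplication formula, Silverman III.2.3(d)): `2P = (x₂, 0)` forces `x₂ = 0`
   (`x² − 2mx + p = (x − m)² + 4 > 0`), and then `4y²·x₂ = (x² − p)²` gives `x² = p` — impossible, `√p ∉ ℚ`.
4. So every torsion point is killed by `2`, i.e. is `O` or `(0, 0)`: `#E′_m(ℚ)_tors = 2`.

HONEST FRAMING: an elementary arithmetic theorem about an explicit family; it retires one typed «paper theorem» row of the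
cell (E-an-103♭) and, with E-an-103♯ (Tamagawa law, still open), gives the support row E-an-103 `BlindFamilyLocalTerms` used
by the family-level cusp criterion E-an-104/105.  Nothing here bears on BSD or proves Manin's conjecture; C2 stays OPEN.

References: [Knapp1993] Ch. V Thm. 5.1(c), 5.2 (PDF pp. 97, 101, 112); [SilvermanAEC2009] III.2.3(d), VII.1 Rem. 1.1,
VII.3.1(b); cell memo MEMO-an §65 (census g23: 1485/1485).
-/

set_option autoImplicit false
-- `Summit.BirchSwinnertonDyer.BirchSwinnertonDyer` is the mandated summit-side namespace (single-conjunct summit).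
set_option linter.dupNamespace false

noncomputable section

open scoped Classical

open WeierstrassCurve Literature.NumberTheory.EllipticCurves
  Literature.NumberTheory.EllipticCurves.Rank1Residual.X11RankOneCertificates
  Summit.BirchSwinnertonDyer.Rank1Residual.ManinAdditive
  Summit.BirchSwinnertonDyer.Rank1Residual.ManinAdditive.ShimuraLedger
  Summit.BirchSwinnertonDyer.Rank1Residual.ManinAdditive.BlindFamilyDescent
  Summit.BirchSwinnertonDyer.Rank1Residual.Supersingular
  Summit.BirchSwinnertonDyer.BirchSwinnertonDyer.Rank1Residual.IntModel
  Summit.BirchSwinnertonDyer.BirchSwinnertonDyer.Rank1Residual.X11RankOne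

namespace Summit.BirchSwinnertonDyer.BirchSwinnertonDyer.Theorems.ManinLocalTwoThree

/-! ### §0 Finite bookkeeping in `ZMod 3`, `ZMod 5` -/

/-- The five residues mod `5`. [folklore] -/
theorem zmod5_cases : ∀ z : ZMod 5, z = 0 ∨ z = 1 ∨ z = 2 ∨ z = 3 ∨ z = 4 := by decide
/-- `z² + 4 ≠ 0` in `𝔽₃` (`−1` is not a square mod `3`). [folklore] -/
theorem zmod3_sq_add_four_ne_zero : ∀ z : ZMod 3, z ^ 2 + 4 ≠ 0 := by decide
/-- `1² + 4 = 0` in `𝔽₅`. [folklore] -/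
theorem zmod5_one_sq_add_four : (1 : ZMod 5) ^ 2 + 4 = 0 := by decide
/-- `4² + 4 = 0` in `𝔽₅`. [folklore] -/
theorem zmod5_four_sq_add_four : (4 : ZMod 5) ^ 2 + 4 = 0 := by decide

/-! ### §1 The integer model, its invariants, global minimality -/

/-- The blind curve is the base change of the integer model `[0, −2m, 0, m² + 4, 0]`. [folklore] -/
theorem blindCurve_eq_intCast (m : ℤ) :
    blindCurve m = (⟨((0 : ℤ) : ℚ), ((-2 * m : ℤ) : ℚ), ((0 : ℤ) : ℚ), ((m ^ 2 + 4 : ℤ) : ℚ), ((0 : ℤ) : ℚ)⟩ :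
      WeierstrassCurve ℚ) := by
  simp only [blindCurve]
  push_cast
  rfl

/-- `Δ[0, −2m, 0, m² + 4, 0] = −256 (m² + 4)²`. [cite: SilvermanAEC2009, III.1] -/
theorem discOf_blind (m : ℤ) : discOf [0, -2 * m, 0, m ^ 2 + 4, 0] = -256 * (m ^ 2 + 4) ^ 2 := by
  rw [← intCurve_Δ]
  simp only [WeierstrassCurve.Δ, WeierstrassCurve.b₂, WeierstrassCurve.b₄, WeierstrassCurve.b₆, WeierstrassCurve.b₈]
  ring

/-- `c₄[0, −2m, 0, m² + 4, 0] = 16 (m² − 12)`. [cite: SilvermanAEC2009, III.1] -/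
theorem c4Of_blind (m : ℤ) : c4Of [0, -2 * m, 0, m ^ 2 + 4, 0] = 16 * (m ^ 2 - 12) := by
  rw [← intCurve_c₄]
  simp only [WeierstrassCurve.c₄, WeierstrassCurve.b₂, WeierstrassCurve.b₄]
  ring

/-- For odd `m`, `m² + 4` is odd. [folklore] -/
theorem odd_sq_add_four {m : ℤ} (hm : Odd m) : Odd (m ^ 2 + 4) := by
  obtain ⟨k, rfl⟩ := hm
  exact ⟨2 * k ^ 2 + 2 * k + 2, by ring⟩

/-- **`E′_m` is a global minimal model** for odd `m` (Silverman's criterion at every prime). [cite: SilvermanAEC2009, VII.1 Remark 1.1] -/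
theorem isGloballyMinimal_blindCurve {m : ℤ} (hm : Odd m) : (blindCurve m).IsGloballyMinimal := by
  rw [blindCurve_eq_intCast]
  refine isGloballyMinimal_of_int_criterion 0 (-2 * m) 0 (m ^ 2 + 4) 0 fun q hq ⟨h12, h4⟩ ↦ ?_
  rw [discOf_blind] at h12
  rw [c4Of_blind] at h4
  have hodd : Odd (m ^ 2 + 4) := odd_sq_add_four hm
  rcases hq.eq_two_or_odd' with rfl | hqodd
  · -- `2¹² ∣ 2⁸ (m²+4)²` with `m² + 4` odd: impossible
    have h : ((2 : ℕ) : ℤ) ^ 12 ∣ 2 ^ 8 * (m ^ 2 + 4) ^ 2 := by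
      have e : -256 * (m ^ 2 + 4) ^ 2 = -(2 ^ 8 * (m ^ 2 + 4) ^ 2) := by ring
      rw [e, dvd_neg] at h12
      exact h12
    have h16 : (2 : ℤ) ^ 4 ∣ (m ^ 2 + 4) ^ 2 := by
      have e : ((2 : ℕ) : ℤ) ^ 12 = 2 ^ 8 * 2 ^ 4 := by norm_num
      rw [e] at h
      exact (mul_dvd_mul_iff_left (by norm_num : (2 : ℤ) ^ 8 ≠ 0)).mp h
    have h2 : (2 : ℤ) ∣ (m ^ 2 + 4) ^ 2 := (dvd_pow_self 2 (by norm_num)).trans h16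
    have h2' : (2 : ℤ) ∣ m ^ 2 + 4 := Int.prime_two.dvd_of_dvd_pow h2
    exact (Int.not_even_iff_odd.mpr hodd) (even_iff_two_dvd.mpr h2')
  · -- odd `q`: `q ∣ m² + 4` and `q ∣ m² − 12`, so `q ∣ 16`
    have hqZ : Prime (q : ℤ) := Nat.prime_iff_prime_int.mp hq
    have hq2 : ¬ (q : ℤ) ∣ 2 := by
      intro h
      have : q ∣ 2 := by exact_mod_cast h
      have h22 := (Nat.prime_dvd_prime_iff_eq hq Nat.prime_two).mp this
      rcases hqodd with ⟨k, hk⟩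
      omega
    have hA : (q : ℤ) ∣ m ^ 2 + 4 := by
      have h1 : (q : ℤ) ∣ -256 * (m ^ 2 + 4) ^ 2 := (dvd_pow_self (q : ℤ) (by norm_num)).trans h12
      rw [dvd_neg.symm, neg_mul, neg_neg] at h1
      rcases hqZ.dvd_or_dvd h1 with h | h
      · exfalso
        have : (q : ℤ) ∣ 2 ^ 8 := by norm_num at h ⊢; exact h
        exact hq2 (hqZ.dvd_of_dvd_pow this)
      · exact hqZ.dvd_of_dvd_pow h
    have hB : (q : ℤ) ∣ m ^ 2 - 12 := by
      have h1 : (q : ℤ) ∣ 16 * (m ^ 2 - 12) := (dvd_pow_self (q : ℤ) (by norm_num)).trans h4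
      rcases hqZ.dvd_or_dvd h1 with h | h
      · exfalso
        have : (q : ℤ) ∣ 2 ^ 4 := by norm_num at h ⊢; exact h
        exact hq2 (hqZ.dvd_of_dvd_pow this)
      · exact h
    have h16 : (q : ℤ) ∣ 2 ^ 4 := by
      have := dvd_sub hA hB
      have e : m ^ 2 + 4 - (m ^ 2 - 12) = 2 ^ 4 := by ring
      rwa [e] at this
    exact hq2 (hqZ.dvd_of_dvd_pow h16)

/-- The integer model of the (globally minimal) blind curve. [folklore] -/
theorem integralModelInt_blindCurve {m : ℤ} (hm : Odd m) :
    haveI := isGloballyMinimal_blindCurve hm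
    integralModelInt (blindCurve m) = ⟨0, -2 * m, 0, m ^ 2 + 4, 0⟩ := by
  haveI := isGloballyMinimal_blindCurve hm
  refine integralModelInt_eq_of_map_eq _ ?_
  rw [blindCurve_eq_intCast]
  simp [WeierstrassCurve.map]

/-- `ℓ ∤ Δ_min(E′_m)` whenever `ℓ ∤ 2 (m² + 4)` (`Δ_min = −2⁸ (m² + 4)²`). [folklore] -/
theorem not_dvd_minimalDiscriminantInt_blindCurve {m : ℤ} (hm : Odd m) {ℓ : ℕ} (hℓ : ℓ.Prime)
    (hℓ2 : ℓ ≠ 2) (hℓp : ¬ (ℓ : ℤ) ∣ m ^ 2 + 4) :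
    haveI := isGloballyMinimal_blindCurve hm
    ¬ (ℓ : ℤ) ∣ minimalDiscriminantInt (blindCurve m) := by
  haveI := isGloballyMinimal_blindCurve hm
  refine not_dvd_minimalDiscriminantInt_of_intModel (integralModelInt_blindCurve hm) ?_
  rw [discOf_blind]
  have hqZ : Prime (ℓ : ℤ) := Nat.prime_iff_prime_int.mp hℓ
  have hq2 : ¬ (ℓ : ℤ) ∣ 2 := by
    intro h
    have : ℓ ∣ 2 := by exact_mod_cast h
    have := (Nat.prime_dvd_prime_iff_eq hℓ Nat.prime_two).mp this
    exact hℓ2 this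
  intro h
  rw [dvd_neg.symm, neg_mul, neg_neg] at h
  rcases hqZ.dvd_or_dvd h with h | h
  · have : (ℓ : ℤ) ∣ 2 ^ 8 := by norm_num at h ⊢; exact h
    exact hq2 (hqZ.dvd_of_dvd_pow this)
  · exact hℓp (hqZ.dvd_of_dvd_pow h)

/-! ### §2 The reductions at `3` and `5` by residue class -/

/-- The reduction of the integer model mod `ℓ` only depends on `m mod ℓ`. [folklore] -/
theorem map_blind_eq_of_cast_eq {ℓ : ℕ} [NeZero ℓ] {m r : ℤ} (h : (m : ZMod ℓ) = (r : ZMod ℓ)) :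
    (⟨0, -2 * m, 0, m ^ 2 + 4, 0⟩ : WeierstrassCurve ℤ).map (Int.castRingHom (ZMod ℓ)) =
      (⟨0, -2 * r, 0, r ^ 2 + 4, 0⟩ : WeierstrassCurve ℤ).map (Int.castRingHom (ZMod ℓ)) := by
  simp only [WeierstrassCurve.map, eq_intCast]
  push_cast
  rw [h]

/-- `#Ẽ′_m(𝔽₃) ∈ {4, 6, 2}` according to `m ≡ 0, 1, 2 (mod 3)`. [cite: SilvermanAEC2009, VII.5 Prop. 5.1(a)] -/
theorem reductionPointCount_blindCurve_three {m : ℤ} (hm : Odd m) :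
    haveI := isGloballyMinimal_blindCurve hm
    (blindCurve m).reductionPointCount 3 = 4 ∨ (blindCurve m).reductionPointCount 3 = 6 ∨
      (blindCurve m).reductionPointCount 3 = 2 := by
  haveI := isGloballyMinimal_blindCurve hm
  haveI : Fact (Nat.Prime 3) := ⟨Nat.prime_three⟩
  rw [reductionPointCount, integralModelInt_blindCurve hm]
  have hcases := Summit.BirchSwinnertonDyer.Rank1Residual.X5.Instances.zmod_three_cases
  rcases hcases (m : ZMod 3) with h | h | h
  · left
    rw [map_blind_eq_of_cast_eq (r := 0) (by rw [h]; simp)]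
    exact natCard_point_eq_of_countPoints 0 (-2 * 0) 0 (0 ^ 2 + 4) 0 3 (by norm_num) (by decide +kernel)
      (countPoints_eq_of_fast (by decide +kernel))
  · right; left
    rw [map_blind_eq_of_cast_eq (r := 1) (by rw [h]; simp)]
    exact natCard_point_eq_of_countPoints 0 (-2 * 1) 0 (1 ^ 2 + 4) 0 3 (by norm_num) (by decide +kernel)
      (countPoints_eq_of_fast (by decide +kernel))
  · right; right
    rw [map_blind_eq_of_cast_eq (r := 2) (by rw [h]; simp)]
    exact natCard_point_eq_of_countPoints 0 (-2 * 2) 0 (2 ^ 2 + 4) 0 3 (by norm_num) (by decide +kernel)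
      (countPoints_eq_of_fast (by decide +kernel))

/-- `#Ẽ′_m(𝔽₅) ∈ {8, 4}` when `5 ∤ m² + 4` (i.e. `m ≢ ±1 (mod 5)`). [cite: SilvermanAEC2009, VII.5 Prop. 5.1(a)] -/
theorem reductionPointCount_blindCurve_five {m : ℤ} (hm : Odd m) (h5 : ¬ (5 : ℤ) ∣ m ^ 2 + 4) :
    haveI := isGloballyMinimal_blindCurve hm
    (blindCurve m).reductionPointCount 5 = 8 ∨ (blindCurve m).reductionPointCount 5 = 4 := by
  haveI := isGloballyMinimal_blindCurve hm
  haveI : Fact (Nat.Prime 5) := ⟨by norm_num⟩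
  rw [reductionPointCount, integralModelInt_blindCurve hm]
  have hcases := zmod5_cases
  -- `m ≡ ±1 (mod 5)` is excluded by `5 ∤ m² + 4`
  have hexcl : (m : ZMod 5) ≠ 1 ∧ (m : ZMod 5) ≠ 4 := by
    constructor
    · intro h
      apply h5
      have hz : ((m ^ 2 + 4 : ℤ) : ZMod 5) = 0 := by push_cast; rw [h]; exact zmod5_one_sq_add_four
      exact_mod_cast (ZMod.intCast_zmod_eq_zero_iff_dvd (m ^ 2 + 4) 5).mp hz
    · intro h
      apply h5
      have hz : ((m ^ 2 + 4 : ℤ) : ZMod 5) = 0 := by push_cast; rw [h]; exact zmod5_four_sq_add_four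
      exact_mod_cast (ZMod.intCast_zmod_eq_zero_iff_dvd (m ^ 2 + 4) 5).mp hz
  rcases hcases (m : ZMod 5) with h | h | h | h | h
  · left
    rw [map_blind_eq_of_cast_eq (r := 0) (by rw [h]; simp)]
    exact natCard_point_eq_of_countPoints 0 (-2 * 0) 0 (0 ^ 2 + 4) 0 5 (by norm_num) (by decide +kernel)
      (countPoints_eq_of_fast (by decide +kernel))
  · exact absurd h hexcl.1
  · right
    rw [map_blind_eq_of_cast_eq (r := 2) (by rw [h]; simp)]
    exact natCard_point_eq_of_countPoints 0 (-2 * 2) 0 (2 ^ 2 + 4) 0 5 (by norm_num) (by decide +kernel)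
      (countPoints_eq_of_fast (by decide +kernel))
  · right
    rw [map_blind_eq_of_cast_eq (r := 3) (by rw [h]; simp)]
    exact natCard_point_eq_of_countPoints 0 (-2 * 3) 0 (3 ^ 2 + 4) 0 5 (by norm_num) (by decide +kernel)
      (countPoints_eq_of_fast (by decide +kernel))
  · exact absurd h hexcl.2


end Summit.BirchSwinnertonDyer.BirchSwinnertonDyer.Theorems.ManinLocalTwoThree

end
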